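import Summits.HodgeConjecture.CorCM.Census.ResidualReductionTools
import Summits.HodgeConjecture.CorCM.Census.BaseBlockCovering
import Summits.HodgeConjecture.CorCM.Census.BlockParityRelations

/-!
# Near types of a base block: the residual types are the base changes of `T₀` and of its single flips; potential `2` = double flips

COR-CM (cell `pub-hodgecm2`), count-neutral kernel combinatorics by the binder seat b09 (gen 38; lane TWO-ADIC SPLITTING +
NONDEGENERATE REDUCTION, part M), sequel of parts C `Census/BaseBlockCovering.lean` (`bpot`) and J `Census/ResidualReductionTools.lean`
(`smul_single_rt_mem_target`), with the Prior lemmas `eq_of_dev_empty`, `eq_oflip_of_dev_singleton`, `dev_oflip` and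
`BlockParity.oflipCM_oflipCM_self` used BY NAME.  Theorems only: no definition, no `decide`, no certificate, no named fact, no `sorry`.
HONEST FRAMING: `HC_CM` is NOT proved, here or anywhere in the tree; nothing here is a period or a headline.

* §1 **Shape of the near types.**  `bpot T₀ Φ = 0 ⟺ Φ` is a base change of `T₀` (`exists_rt_of_bpot_eq_zero`); `bpot T₀ Φ = 1 ⟹ Φ = (T₀^{(s)})·Q⁻¹`
  for a place `s ∈ T₀` (`exists_rt_oflipCM_of_bpot_eq_one`); `bpot T₀ Φ = 2 ⟹ Φ = (T₀^{(s)(s')})·Q⁻¹` for two places `s ≠ s'` of `T₀`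
  (`exists_rt_oflipCM_oflipCM_of_bpot_eq_two`).  So the residual blocks of the meta-theorem are the blocks of `T₀` and of its `|T₀|` single
  flips, and the potential-`2` blocks (the explicit part of a threshold-`3` covering, part K) are the blocks of its double flips.
* §2 **RESIDUAL REDUCTION FROM THE SINGLE FLIPS OF `T₀`** (`residual_reduction_of_single_flips`): if `2^k·[T₀^{(s)}] ∈ 𝓣(S, T₀)` for every place
  `s ∈ T₀`, then `2^k·[Ψ] ∈ 𝓣(S, T₀)` for EVERY residual type `Ψ` (`bpot T₀ Ψ ≤ 1`) — the hypothesis `hres` of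
  `Splitting.isLeast_card_gfaces_generate_of_residual_reduction` from `|T₀| = |G|/2` checks at the base type.

## References
* [Pohlmann1968] H. Pohlmann, Algebraic cycles on abelian varieties of complex multiplication type, Ann. of Math. 88 (1968), Thm 1.
-/

namespace Summit.HodgeConjecture.CorCM.Census.BaseBlock

open Finset
open Summit.HodgeConjecture.CorCM.Prior.AllgGroup.RfwfAllgGroup
open Summit.HodgeConjecture.CorCM.Census.BlockParity
open Summit.HodgeConjecture.CorCM.Census.Coinvariant
open Summit.HodgeConjecture.CorCM.Census.Nondegenerate
open Summit.HodgeConjecture.CorCM.Census.TwistGeneration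

noncomputable section

variable {G : Type*} [Group G] [Fintype G] [DecidableEq G] (c : G) (T₀ : CMF G c)

/-! ## §1 The shape of the types of potential `0`, `1`, `2` -/

/-- The base changes of `T₀` have potential `0`. [folklore] -/
theorem bpot_rt_base (Q : G) : bpot c T₀ (rt c Q T₀) = 0 := by
  have h := bpot_le c T₀ (rt c Q T₀) Q
  rw [ddist_self] at h
  omega

/-- **Potential `0` = the base block**: `bpot T₀ Φ = 0 ⟹ Φ = T₀·Q⁻¹` for some `Q`. [folklore] -/
theorem exists_rt_of_bpot_eq_zero {Φ : CMF G c} (h : bpot c T₀ Φ = 0) : ∃ Q : G, Φ = rt c Q T₀ := by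
  obtain ⟨Q, hQ⟩ := exists_bpot_eq c T₀ Φ
  refine ⟨Q, ?_⟩
  rw [h, ddist, eq_comm, Finset.card_eq_zero] at hQ
  exact eq_of_dev_empty c hQ

/-- A single flip of a base change has potential `≤ 1`. [folklore] -/
theorem bpot_oflipCM_rt_le_one (hc2 : c * c = 1) (Q : G) {s : G} (hs : s ∈ (rt c Q T₀).1) :
    bpot c T₀ (oflipCM c hc2 s (rt c Q T₀)) ≤ 1 := by
  have h := bpot_le c T₀ (oflipCM c hc2 s (rt c Q T₀)) Q
  have hd : ddist (rt c Q T₀) (oflipCM c hc2 s (rt c Q T₀)) = 1 := by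
    unfold ddist
    rw [dev_oflip_of_mem c hc2 hs hs, sdiff_self, Finset.bot_eq_empty, insert_empty_eq, card_singleton]
  omega

/-- **Potential `1` = single flips of base changes**: `bpot T₀ Φ = 1 ⟹ Φ = (T₀^{(s)})·Q⁻¹` for some `Q` and some place `s ∈ T₀`. [folklore] -/
theorem exists_rt_oflipCM_of_bpot_eq_one (hc2 : c * c = 1) {Φ : CMF G c} (h : bpot c T₀ Φ = 1) :
    ∃ Q s : G, s ∈ T₀.1 ∧ Φ = rt c Q (oflipCM c hc2 s T₀) := by
  obtain ⟨Q, hQ⟩ := exists_bpot_eq c T₀ Φ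
  rw [h, ddist, eq_comm, Finset.card_eq_one] at hQ
  obtain ⟨t, ht⟩ := hQ
  have htmem : t ∈ (rt c Q T₀).1 := (mem_sdiff.mp (ht ▸ mem_singleton_self t)).1
  have hΦ : Φ = oflipCM c hc2 t (rt c Q T₀) := eq_oflip_of_dev_singleton c hc2 ht
  refine ⟨Q, t * Q, (mem_rt c Q T₀ t).mp htmem, ?_⟩
  rw [hΦ, rt_oflipCM, mul_inv_cancel_right]

/-- **Potential `2` = double flips of base changes**: `bpot T₀ Φ = 2 ⟹ Φ = (T₀^{(s)(s')})·Q⁻¹` for some `Q` and two places `s ≠ s'` of `T₀`.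
[folklore] -/
theorem exists_rt_oflipCM_oflipCM_of_bpot_eq_two (hc2 : c * c = 1) {Φ : CMF G c} (h : bpot c T₀ Φ = 2) :
    ∃ Q s s' : G, s ∈ T₀.1 ∧ s' ∈ T₀.1 ∧ s ≠ s' ∧ Φ = rt c Q (oflipCM c hc2 s (oflipCM c hc2 s' T₀)) := by
  obtain ⟨Q, hQ⟩ := exists_bpot_eq c T₀ Φ
  rw [h, ddist, eq_comm, Finset.card_eq_two] at hQ
  obtain ⟨t, t', htt', hdev⟩ := hQ
  have ht : t ∈ (rt c Q T₀).1 \ Φ.1 := hdev ▸ (mem_insert_self t {t'})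
  have ht' : t' ∈ (rt c Q T₀).1 \ Φ.1 := hdev ▸ (mem_insert_of_mem (mem_singleton_self t'))
  -- flip `Φ` back at `t`: the deviation set becomes `{t'}`
  have hdev1 : (rt c Q T₀).1 \ (oflipCM c hc2 t Φ).1 = {t'} := by
    rw [dev_oflip c hc2 (mem_sdiff.mp ht).1 (mem_sdiff.mp ht).2, hdev, erase_insert]
    exact fun hmem => htt' (mem_singleton.mp hmem)
  have h1 : oflipCM c hc2 t Φ = oflipCM c hc2 t' (rt c Q T₀) := eq_oflip_of_dev_singleton c hc2 hdev1
  have hΦ : Φ = oflipCM c hc2 t (oflipCM c hc2 t' (rt c Q T₀)) := by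
    rw [← h1, oflipCM_oflipCM_self]
  refine ⟨Q, t * Q, t' * Q, (mem_rt c Q T₀ t).mp (mem_sdiff.mp ht).1, (mem_rt c Q T₀ t').mp (mem_sdiff.mp ht').1,
    fun e => htt' (mul_right_cancel e), ?_⟩
  rw [hΦ, rt_oflipCM, rt_oflipCM, mul_inv_cancel_right, mul_inv_cancel_right]

/-- The residual dichotomy: a type of potential `≤ 1` is a base change of `T₀` or of a single flip of `T₀`. [folklore] -/
theorem residual_cases (hc2 : c * c = 1) {Φ : CMF G c} (h : bpot c T₀ Φ ≤ 1) :
    (∃ Q : G, Φ = rt c Q T₀) ∨ ∃ Q s : G, s ∈ T₀.1 ∧ Φ = rt c Q (oflipCM c hc2 s T₀) := by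
  rcases Nat.lt_or_ge (bpot c T₀ Φ) 1 with h0 | h1
  · exact Or.inl (exists_rt_of_bpot_eq_zero c T₀ (by omega))
  · exact Or.inr (exists_rt_oflipCM_of_bpot_eq_one c T₀ hc2 (by omega))

/-! ## §2 Residual reduction from the single flips of the base type -/

/-- **RESIDUAL REDUCTION FROM THE SINGLE FLIPS OF `T₀`.**  If every single flip `T₀^{(s)}` (`s ∈ T₀`) satisfies `2^k·[T₀^{(s)}] ∈ 𝓣(S, T₀)`, then so
does every residual type. [folklore] -/
theorem residual_reduction_of_single_flips (hc2 : c * c = 1) (hcen : ∀ x : G, x * c = c * x) (S : Finset (CMF G c →₀ ℤ)) (k : ℕ)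
    (hflip : ∀ s ∈ T₀.1, ((2 : ℤ) ^ k) • Finsupp.single (oflipCM c hc2 s T₀) (1 : ℤ) ∈
      (Submodule.span ℤ (pairSet c) ⊔ Submodule.span ℤ (translates c S)) ⊔
        Submodule.span ℤ (Set.range fun Q : G => Finsupp.single (rt c Q T₀) (1 : ℤ))) :
    ∀ Ψ : CMF G c, bpot c T₀ Ψ ≤ 1 → ((2 : ℤ) ^ k) • Finsupp.single Ψ (1 : ℤ) ∈
      (Submodule.span ℤ (pairSet c) ⊔ Submodule.span ℤ (translates c S)) ⊔
        Submodule.span ℤ (Set.range fun Q : G => Finsupp.single (rt c Q T₀) (1 : ℤ)) := by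
  intro Ψ hΨ
  rcases residual_cases c T₀ hc2 hΨ with ⟨Q, rfl⟩ | ⟨Q, s, hs, rfl⟩
  · exact Submodule.smul_mem _ _ (single_rt_mem_target c S T₀ Q)
  · exact smul_single_rt_mem_target c S T₀ hcen Q _ (hflip s hs)

/-- **The meta-hypothesis `hres` at the base type**: combined form for `Splitting.isLeast_card_gfaces_generate_of_residual_reduction` — nothing
but the `|T₀|` single flips of `T₀` need an explicit reduction. [folklore] -/
theorem residual_reduction_iff_single_flips (hc2 : c * c = 1) (hcen : ∀ x : G, x * c = c * x) (S : Finset (CMF G c →₀ ℤ)) (k : ℕ) :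
    (∀ Ψ : CMF G c, bpot c T₀ Ψ ≤ 1 → ((2 : ℤ) ^ k) • Finsupp.single Ψ (1 : ℤ) ∈
      (Submodule.span ℤ (pairSet c) ⊔ Submodule.span ℤ (translates c S)) ⊔
        Submodule.span ℤ (Set.range fun Q : G => Finsupp.single (rt c Q T₀) (1 : ℤ))) ↔
    ∀ s ∈ T₀.1, ((2 : ℤ) ^ k) • Finsupp.single (oflipCM c hc2 s T₀) (1 : ℤ) ∈
      (Submodule.span ℤ (pairSet c) ⊔ Submodule.span ℤ (translates c S)) ⊔
        Submodule.span ℤ (Set.range fun Q : G => Finsupp.single (rt c Q T₀) (1 : ℤ)) := by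
  refine ⟨fun h s hs => ?_, residual_reduction_of_single_flips c T₀ hc2 hcen S k⟩
  have h1 := bpot_oflipCM_rt_le_one c T₀ hc2 1 (by rw [rt_one]; exact hs)
  rw [rt_one] at h1
  exact h _ h1

end

end Summit.HodgeConjecture.CorCM.Census.BaseBlock
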